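import Mathlib
import HarnessLib
import Literature.MathematicalPhysics.QuantumFieldTheory.YangMillsOS
import Literature.MathematicalPhysics.QuantumFieldTheory.StrongCouplingInfiniteVolume
import Summits.QuantumFields.YangMills.Theses.PencilRigidity
import Summits.QuantumFields.YangMills.Theses.MirrorModularBoosts
import Summits.QuantumFields.YangMills.Theses.CertificationLength
import Summits.QuantumFields.YangMills.Theses.IsotropyFromPowerCounting
import Summits.QuantumFields.YangMills.Theorems.PencilRigidityCurvatureKernelBoundSplit
import Summits.QuantumFields.YangMills.Theorems.PencilRigidityCurvatureKernelBoundFiniteCouplingStrongTemperedR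
import Summits.QuantumFields.YangMills.Theorems.PencilRigidityCurvatureKernelBoundFiniteCouplingStrongMildlyExtensive

/-!

v17 DRAFT — FOLDER ONLY, NOT published / registered (registry of record = v16 32993cd0891256a0, RATIFIED R651-ym (1)); owed per idea-crit-9 VERDICT #101 P2:
IMPORTS + ONE SPLIT, STATEMENTS UNTOUCHED — (i) the landed glue `Theorems.PencilRigidityCurvatureKernelBoundSplit` (p137385) and the bricks
`…FiniteCouplingStrongTemperedR` (p156874) / `…FiniteCouplingStrongMildlyExtensive` (p157183) are IMPORTED (modules BUILT since gate12 07:14Z) instead of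
inlined / vendored; (ii) child 2 is registered as its two OPEN residues `stub_finiteCouplingStrongHyperCore` + `stub_finiteCouplingBeyondDisc` (v14's stub names
and signatures, verbatim), child 2 as a whole being DERIVED (`finiteCoupling_of_partsR`); registered stubs = v14's four: `stub_weakCoupling`,
`stub_finiteCouplingStrongHyperCore`, `stub_finiteCouplingBeyondDisc`, `stub_negativeCoupling`. bears_on: R2a. The v16 prose below about «no oleans» is historical.
# Line `coupling-trichotomy` — crux stmt-QuantumFields-11687 `CurvatureKernelBound` (skeleton v15, line-writer seat, 2026-08-31)

HONEST FRAMING (director-ym R645-ym, verbatim obligation). The routes wanting this crux (MirrorModularBoosts r3,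
IsotropyFromPowerCounting r4, PencilRigidity r4, CertificationLength r5) conclude `YangMills` only through
`WeakCouplingHypercubicLimit`-type existence legs that stay OPEN and summit-strength; this registered skeleton is a typed
plan for ONE leaf, not progress on the Clay problem; the Yang–Mills mass gap is NOT proved. Its hardest stub
`stub_weakCoupling` is the ultraviolet half of the four-dimensional Yang–Mills construction restricted to the curvature channel
(fourteen leads c1–c13 + strategist STRATEGY-CENSUS v3: «no strategy short of the construction»); it is PARKED, typed, not claimed solved.

v15 (planner-linewriter-ym-o4cluster-g0, 2026-08-31) — PORTABLE re-materialisation of lead c13's v14 (2026-08-17, Cruxes commit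
f3cb41002d7d). Why a new file: (i) every earlier registration pointed at a swept session folder
(`run/sessions/prover-line-…/work/CurvatureKernelBound.lean`, gone) — hence «skeleton-less» in the R645 census; (ii) on 2026-08-31 the hub
has NO oleans for the cluster's landed Theorems modules (`…CurvatureKernelBoundSplit` p137385, `…FiniteCouplingStrongTemperedR` p156874,
`…FiniteCouplingStrongMildlyExtensive` p157183 and ~330 further IFPC/PR/MMB modules — invalidated by HarnessLib/Literature rebuilds and not
rebuilt since the routes went dormant), so a skeleton importing them cannot be elaborated (`remote:stale:…:unbuilt:…`, rc 75). This file
therefore imports ONLY the four route files + `YangMillsOS`, INLINES the landed glue p137385 verbatim (namespace `…CouplingTrichotomyPortable.Glue`;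
same text as `Theorems/PencilRigidityCurvatureKernelBoundSplit.lean`, nothing new claimed), and registers the THREE children as stubs:
`stub_weakCoupling` (child 1), `stub_finiteCoupling` (child 2), `stub_negativeCoupling` (child 3). The finer state of child 2 is recorded
kernel-checked but import-free: `finiteCoupling_of_partsR : TemperedR → MildlyExtensive → HyperCore → BeyondDisc → FiniteCoupling` (pure
logic), where `FiniteCouplingStrongTemperedR` and `FiniteCouplingStrongMildlyExtensive` are TREE THEOREMS (p156874, p157183: Osterwalder–Seiler
cluster expansion on the full disc + swap RP + Hankel log-convexity, lead c9–c11 waves) — so the OPEN content of `stub_finiteCoupling` is exactly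
`FiniteCouplingStrongHyperCore` + `FiniteCouplingBeyondDisc` (v14's stubs of those names, signatures verbatim below as `def`s).

THE LINE (strategist D1 «coupling trichotomy»): the crux quantifies over EVERY species scheme `sch`; by sequential compactness of `EReal` and
subsequence-invariance of the curvature package `W₁`, it splits along the fate of the bare coupling `β_k`:
* child 1 `WeakCoupling` (`sch.HasWeakCouplingLimit`, `β_k → +∞`) = `stub_weakCoupling` — THE WALL: a continuous, power-counted
  (`|K x| ≤ C (1 + ‖x‖^(η-10))`) off-diagonal kernel for the curvature two-point function of an asymptotically free continuum limit = UV half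
  of the construction [JaffeWitten2000 §6.5; Balaban1989LargeFieldII; MagnenRivasseauSeneor1993]. The ONLY stub any sharing route's `closes`
  instantiates (all four existence legs feed `K` a scheme with `HasWeakCouplingLimit`).
* child 2 `FiniteCoupling` (`β_k → b ∈ ℝ`) = `stub_finiteCoupling` — SCOPE ARTEFACT of the pre-p116790 `∀ sch` (continuum limits AT finite bare
  coupling); open residue = super-extensive renormalisation inside the disc (two-sided strong-coupling asymptotics / tube dominance [Schor1983])
  + `betaOne ≤ |b|` (lattice-gauge phase structure [MontvayMunster1994 §3.7]).
* child 3 `NegativeCoupling` (`β_k → −∞`) = `stub_negativeCoupling` — SCOPE ARTEFACT (frustrated coupling, no RP on odd tori).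
`curvatureKernelBound_of_children : WeakCoupling → FiniteCoupling → NegativeCoupling → <crux body>` (the inlined glue) and
`CurvatureKernelBound_of : PencilRigidity.CurvatureKernelBound` (from the three `stub_*`; the item's decl of record) — plus
`…_of_MirrorModularBoosts`, `…_of_IsotropyFromPowerCounting`, `…_of_CertificationLength` for the verbatim copies (`shared_iff_* := Iff.rfl`). `sorry` occurs EXACTLY in the three `stub_*`.
Dead lines of this crux (c7, `Lines/*-dead.md`): sixteen-charts-analytic-kernel (dies at the k-uniform smeared window bound E^sm = the
construction; crux ⟺ T ⟺ E^ev ⟺ E^fr are tree theorems p131429/p132686/p132803), axis-extremal-collapse (`stub_schemeDichotomy` open/likely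
false, `stub_uvWindowMajorant` = construction in axis currency), block-filtration-covariance-ladder (`stub_ladder` = Bałaban RG with a
composite observable; barrier `UVStabilityNonUniqueness`). Disproof.lean (cdisprove, 2026-08-16): NO KILL; its `_false_without_` theorems say
any proof must USE the lattice tie for the order of the singularity — every stub here keeps `W₁` verbatim (tie included) and adds hypotheses
only on `sch.β`. Earlier versions: v1–v4 strategist, v5–v6 lead c8, v7–v8 lead c9, v9–v10 lead c10, v11–v12 lead c11, v13 lead c12, v14 lead c13.
-/

noncomputable section

open scoped BigOperators Topology SchwartzMap
open MeasureTheory Filter Set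
open Literature.MathematicalPhysics.QuantumLattice Literature.MathematicalPhysics.AQFT
  Literature.MathematicalPhysics.QuantumFieldTheory

namespace Summit.QuantumFields.YangMills.Cruxes.CurvatureKernelBound.CouplingTrichotomyPortable

/-! ## v17: the landed glue p137385 and the bricks p156874 / p157183 are IMPORTED (modules BUILT since gate12 2026-08-31T07:14Z); nothing inlined or vendored. -/

/-! ## The statements (precise `Prop`s, let-free ∀-form; the sorried `stub_<name>` theorems below are the REGISTERED stubs) -/

/-- **Child 1 · WeakCoupling** (route item `CurvatureKernelBoundWeakCoupling`) — the crux restricted to `sch.HasWeakCouplingLimit`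
(`β_k → +∞`): the UV half of the construction at the asymptotically free fixed point, universal over AF schemes; the piece that
remains the whole crux. [JaffeWitten2000 §6.5 fn. 2; Balaban1989LargeFieldII] -/
def WeakCoupling : Prop :=
  open Literature.MathematicalPhysics.QuantumLattice Literature.MathematicalPhysics.AQFT Literature.MathematicalPhysics.QuantumFieldTheory in ∀ (G : Type) [Group G] [TopologicalSpace G] [IsTopologicalGroup G] [CompactSpace G] [MeasurableSpace G] [BorelSpace G], IsCompactSimpleLieGroup G → ∀ (r : LatticeRep G) (sch : SpeciesScheme (YMSpecies G)) (S₁ : SchwingerFamily (EuclideanSpace ℝ (Fin 4))), ((∀ (n : ℕ), n ≠ 0 → ∀ (f : Fin n → SchwartzMap ((EuclideanSpace ℝ (Fin 4))) ℝ) (F : SchwartzMap (Fin n → (EuclideanSpace ℝ (Fin 4))) ℂ), IsTensorOf F (fun i => ofRealTest (f i)) → IsOffDiagonal F → Filter.Tendsto (fun k : ℕ => ((latticeSchwinger r.ρ sch (fun s => s.F) k n (fun _ => r.curvature) f : ℝ) : ℂ)) Filter.atTop (nhds (S₁ n F))) ∧ (S₁.toLabelled.IsNormalized ∧ S₁.toLabelled.IsHermitian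 ∧ S₁.toLabelled.HasLinearGrowth ∧ S₁.toLabelled.IsReflectionPositive ∧ S₁.toLabelled.IsSymmetric ∧ S₁.toLabelled.HasClusterProperty) ∧ (∀ (n : ℕ) (a : (EuclideanSpace ℝ (Fin 4))) (F : SchwartzMap (Fin n → (EuclideanSpace ℝ (Fin 4))) ℂ), IsOffDiagonal F → S₁ n (translateMulti a F) = S₁ n F) ∧ (∀ (R : (EuclideanSpace ℝ (Fin 4)) ≃ₗᵢ[ℝ] (EuclideanSpace ℝ (Fin 4))), LinearMap.det (R.toLinearEquiv : (EuclideanSpace ℝ (Fin 4)) →ₗ[ℝ] (EuclideanSpace ℝ (Fin 4))) = 1 → (∀ i : Fin 4, ∃ j : Fin 4, R (EuclideanSpace.single i 1) = EuclideanSpace.single j 1 ∨ R (EuclideanSpace.single i 1) = -EuclideanSpace.single j 1) → ∀ (n : ℕ) (F : SchwartzMap (Fin n → (EuclideanSpace ℝ (Fin 4))) ℂ), IsOffDiagonal F → S₁ n (linActMulti R F) = S₁ n F) ∧ (∃ Δ : ℝ, 0 < Δ ∧ S₁.toLabelled.HasMassGap Δ ∧ HasLatticeMassGap r sch Δ)) →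 sch.HasWeakCouplingLimit → ∃ (K : (EuclideanSpace ℝ (Fin 4)) → ℝ) (C η : ℝ), 0 < η ∧ ContinuousOn K {x : (EuclideanSpace ℝ (Fin 4)) | x ≠ 0} ∧ (∀ x : (EuclideanSpace ℝ (Fin 4)), x ≠ 0 → |K x| ≤ C * (1 + ‖x‖ ^ (η - 10))) ∧ ∀ F : SchwartzMap (Fin 2 → (EuclideanSpace ℝ (Fin 4))) ℂ, IsOffDiagonal F → MeasureTheory.Integrable (fun x : Fin 2 → (EuclideanSpace ℝ (Fin 4)) => (K (x 0 - x 1) : ℂ) * F x) ∧ S₁ 2 F = ∫ x : Fin 2 → (EuclideanSpace ℝ (Fin 4)), (K (x 0 - x 1) : ℂ) * F x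

/-- **Child 2 · FiniteCoupling** (route item `CurvatureKernelBoundFiniteCoupling`) — the crux restricted to `β_k → b ∈ ℝ` (continuum
limits AT finite bare coupling: strong-coupling disc — degenerate, conditionally dischargeable; hypothetical finite-β critical points —
LGT phase structure). SCOPE ARTEFACT. [OsterwalderSeiler1978; MontvayMunster1994 §3.7; Creutz2022 (20.18)] -/
def FiniteCoupling : Prop :=
  open Literature.MathematicalPhysics.QuantumLattice Literature.MathematicalPhysics.AQFT Literature.MathematicalPhysics.QuantumFieldTheory in ∀ (G : Type) [Group G] [TopologicalSpace G] [IsTopologicalGroup G] [CompactSpace G] [MeasurableSpace G] [BorelSpace G], IsCompactSimpleLieGroup G → ∀ (r : LatticeRep G) (sch : SpeciesScheme (YMSpecies G)) (S₁ : SchwingerFamily (EuclideanSpace ℝ (Fin 4))), ((∀ (n : ℕ), n ≠ 0 → ∀ (f : Fin n → SchwartzMap ((EuclideanSpace ℝ (Fin 4))) ℝ) (F : SchwartzMap (Fin n → (EuclideanSpace ℝ (Fin 4))) ℂ), IsTensorOf F (fun i => ofRealTest (f i)) → IsOffDiagonal F → Filter.Tendsto (fun k : ℕ => ((latticeSchwinger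 r.ρ sch (fun s => s.F) k n (fun _ => r.curvature) f : ℝ) : ℂ)) Filter.atTop (nhds (S₁ n F))) ∧ (S₁.toLabelled.IsNormalized ∧ S₁.toLabelled.IsHermitian ∧ S₁.toLabelled.HasLinearGrowth ∧ S₁.toLabelled.IsReflectionPositive ∧ S₁.toLabelled.IsSymmetric ∧ S₁.toLabelled.HasClusterProperty) ∧ (∀ (n : ℕ) (a : (EuclideanSpace ℝ (Fin 4))) (F : SchwartzMap (Fin n → (EuclideanSpace ℝ (Fin 4))) ℂ), IsOffDiagonal F → S₁ n (translateMulti a F) = S₁ n F) ∧ (∀ (R : (EuclideanSpace ℝ (Fin 4)) ≃ₗᵢ[ℝ] (EuclideanSpace ℝ (Fin 4))), LinearMap.det (R.toLinearEquiv : (EuclideanSpace ℝ (Fin 4)) →ₗ[ℝ] (EuclideanSpace ℝ (Fin 4))) = 1 → (∀ i : Fin 4, ∃ j : Fin 4, R (EuclideanSpace.single i 1) = EuclideanSpace.single j 1 ∨ R (EuclideanSpace.single i 1) = -EuclideanSpace.single j 1) → ∀ (n : ℕ) (F : SchwartzMap (Fin n → (EuclideanSpace ℝ (Fin 4))) ℂ),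 IsOffDiagonal F → S₁ n (linActMulti R F) = S₁ n F) ∧ (∃ Δ : ℝ, 0 < Δ ∧ S₁.toLabelled.HasMassGap Δ ∧ HasLatticeMassGap r sch Δ)) → (∃ b : ℝ, Filter.Tendsto sch.β Filter.atTop (nhds b)) → ∃ (K : (EuclideanSpace ℝ (Fin 4)) → ℝ) (C η : ℝ), 0 < η ∧ ContinuousOn K {x : (EuclideanSpace ℝ (Fin 4)) | x ≠ 0} ∧ (∀ x : (EuclideanSpace ℝ (Fin 4)), x ≠ 0 → |K x| ≤ C * (1 + ‖x‖ ^ (η - 10))) ∧ ∀ F : SchwartzMap (Fin 2 → (EuclideanSpace ℝ (Fin 4))) ℂ, IsOffDiagonal F → MeasureTheory.Integrable (fun x : Fin 2 → (EuclideanSpace ℝ (Fin 4)) => (K (x 0 - x 1) : ℂ) * F x) ∧ S₁ 2 F = ∫ x : Fin 2 → (EuclideanSpace ℝ (Fin 4)), (K (x 0 - x 1) : ℂ) * F x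

/-- **Child 3 · NegativeCoupling** (route item `CurvatureKernelBoundNegativeCoupling`) — the crux restricted to `β_k → −∞` (negative /
frustrated Wilson coupling; no reflection positivity on odd tori). SCOPE ARTEFACT. [OsterwalderSeiler1978; Seiler1982] -/
def NegativeCoupling : Prop :=
  open Literature.MathematicalPhysics.QuantumLattice Literature.MathematicalPhysics.AQFT Literature.MathematicalPhysics.QuantumFieldTheory in ∀ (G : Type) [Group G] [TopologicalSpace G] [IsTopologicalGroup G] [CompactSpace G] [MeasurableSpace G] [BorelSpace G], IsCompactSimpleLieGroup G → ∀ (r : LatticeRep G) (sch : SpeciesScheme (YMSpecies G)) (S₁ : SchwingerFamily (EuclideanSpace ℝ (Fin 4))), ((∀ (n : ℕ), n ≠ 0 → ∀ (f : Fin n → SchwartzMap ((EuclideanSpace ℝ (Fin 4))) ℝ) (F : SchwartzMap (Fin n → (EuclideanSpace ℝ (Fin 4))) ℂ), IsTensorOf F (fun i => ofRealTest (f i)) → IsOffDiagonal F → Filter.Tendsto (fun k : ℕ => ((latticeSchwinger r.ρ sch (fun s => s.F) k n (fun _ => r.curvature) f : ℝ) : ℂ)) Filter.atTop (nhds (S₁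 n F))) ∧ (S₁.toLabelled.IsNormalized ∧ S₁.toLabelled.IsHermitian ∧ S₁.toLabelled.HasLinearGrowth ∧ S₁.toLabelled.IsReflectionPositive ∧ S₁.toLabelled.IsSymmetric ∧ S₁.toLabelled.HasClusterProperty) ∧ (∀ (n : ℕ) (a : (EuclideanSpace ℝ (Fin 4))) (F : SchwartzMap (Fin n → (EuclideanSpace ℝ (Fin 4))) ℂ), IsOffDiagonal F → S₁ n (translateMulti a F) = S₁ n F) ∧ (∀ (R : (EuclideanSpace ℝ (Fin 4)) ≃ₗᵢ[ℝ] (EuclideanSpace ℝ (Fin 4))), LinearMap.det (R.toLinearEquiv : (EuclideanSpace ℝ (Fin 4)) →ₗ[ℝ] (EuclideanSpace ℝ (Fin 4))) = 1 → (∀ i : Fin 4, ∃ j : Fin 4, R (EuclideanSpace.single i 1) = EuclideanSpace.single j 1 ∨ R (EuclideanSpace.single i 1) = -EuclideanSpace.single j 1) → ∀ (n : ℕ) (F : SchwartzMap (Fin n → (EuclideanSpace ℝ (Fin 4))) ℂ), IsOffDiagonal F → S₁ n (linActMulti R F) = S₁ n F) ∧ (∃ Δ : ℝ, 0 < Δ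 ∧ S₁.toLabelled.HasMassGap Δ ∧ HasLatticeMassGap r sch Δ)) → Filter.Tendsto sch.β Filter.atTop Filter.atBot → ∃ (K : (EuclideanSpace ℝ (Fin 4)) → ℝ) (C η : ℝ), 0 < η ∧ ContinuousOn K {x : (EuclideanSpace ℝ (Fin 4)) | x ≠ 0} ∧ (∀ x : (EuclideanSpace ℝ (Fin 4)), x ≠ 0 → |K x| ≤ C * (1 + ‖x‖ ^ (η - 10))) ∧ ∀ F : SchwartzMap (Fin 2 → (EuclideanSpace ℝ (Fin 4))) ℂ, IsOffDiagonal F → MeasureTheory.Integrable (fun x : Fin 2 → (EuclideanSpace ℝ (Fin 4)) => (K (x 0 - x 1) : ℂ) * F x) ∧ S₁ 2 F = ∫ x : Fin 2 → (EuclideanSpace ℝ (Fin 4)), (K (x 0 - x 1) : ℂ) * F x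

/-- **Child 2b′ · FiniteCouplingStrongHyperCore** (v11) — the honest residue of child 2 inside the cluster-expansion disc: `|b| < betaOne 4 r.ρ`, hyper-exponential renormalisation, and for EVERY admissible rate `θ` (`e^θ |b| < betaOne`) eventually negative coupling or `θ L_k < log c_k²` (renormalisation SUPER-extensive relative to the finite-size rate; for `b = 0`: `log c_k² / L_k → ∞` along `β_k ≥ 0`). OPEN: negative β has no covariant reflection positivity; super-extensive renormalisation makes the renormalised correlators sensitive to finite-size effects of relative size ≥ 1 and needs a LOWER (relative) bound on bare torus plaquette covariances = two-sided strong-coupling asymptotics. [Schor1983; MontvayMunster1994 (3.439)–(3.440)] -/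
def FiniteCouplingStrongHyperCore : Prop :=
  open Literature.MathematicalPhysics.QuantumLattice Literature.MathematicalPhysics.AQFT Literature.MathematicalPhysics.QuantumFieldTheory in ∀ (G : Type) [Group G] [TopologicalSpace G] [IsTopologicalGroup G] [CompactSpace G] [MeasurableSpace G] [BorelSpace G], IsCompactSimpleLieGroup G → ∀ (r : LatticeRep G) (sch : SpeciesScheme (YMSpecies G)) (S₁ : SchwingerFamily (EuclideanSpace ℝ (Fin 4))), ((∀ (n : ℕ), n ≠ 0 → ∀ (f : Fin n → SchwartzMap ((EuclideanSpace ℝ (Fin 4))) ℝ) (F : SchwartzMap (Fin n → (EuclideanSpace ℝ (Fin 4))) ℂ), IsTensorOf F (fun i => ofRealTest (f i)) → IsOffDiagonal F → Filter.Tendsto (fun k : ℕ => ((latticeSchwinger r.ρ sch (fun s => s.F) k n (fun _ => r.curvature) f : ℝ) : ℂ)) Filter.atTop (nhds (S₁ n F))) ∧ (S₁.toLabelled.IsNormalized ∧ S₁.toLabelled.IsHermitian ∧ S₁.toLabelled.HasLinearGrowth ∧ S₁.toLabelled.IsReflectionPositive ∧ S₁.toLabelled.IsSymmetric ∧ S₁.toLabelled.HasClusterProperty)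 ∧ (∀ (n : ℕ) (a : (EuclideanSpace ℝ (Fin 4))) (F : SchwartzMap (Fin n → (EuclideanSpace ℝ (Fin 4))) ℂ), IsOffDiagonal F → S₁ n (translateMulti a F) = S₁ n F) ∧ (∀ (R : (EuclideanSpace ℝ (Fin 4)) ≃ₗᵢ[ℝ] (EuclideanSpace ℝ (Fin 4))), LinearMap.det (R.toLinearEquiv : (EuclideanSpace ℝ (Fin 4)) →ₗ[ℝ] (EuclideanSpace ℝ (Fin 4))) = 1 → (∀ i : Fin 4, ∃ j : Fin 4, R (EuclideanSpace.single i 1) = EuclideanSpace.single j 1 ∨ R (EuclideanSpace.single i 1) = -EuclideanSpace.single j 1) → ∀ (n : ℕ) (F : SchwartzMap (Fin n → (EuclideanSpace ℝ (Fin 4))) ℂ), IsOffDiagonal F → S₁ n (linActMulti R F) = S₁ n F) ∧ (∃ Δ : ℝ, 0 < Δ ∧ S₁.toLabelled.HasMassGap Δ ∧ HasLatticeMassGap r sch Δ)) → ∀ b : ℝ, Filter.Tendsto sch.β Filter.atTop (nhds b) → |b| < betaOne 4 r.ρ → (∀ δ : ℝ, ∀ᶠ k in Filter.atTop, 1 <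 sch.c r.curvature k ^ 2 * Real.exp (-(δ / sch.a k))) → (∀ θ : ℝ, Real.exp θ * |b| < betaOne 4 r.ρ → ∀ᶠ k in Filter.atTop, sch.β k < 0 ∨ θ * sch.L k < Real.log (sch.c r.curvature k ^ 2)) → ∃ (K : (EuclideanSpace ℝ (Fin 4)) → ℝ) (C η : ℝ), 0 < η ∧ ContinuousOn K {x : (EuclideanSpace ℝ (Fin 4)) | x ≠ 0} ∧ (∀ x : (EuclideanSpace ℝ (Fin 4)), x ≠ 0 → |K x| ≤ C * (1 + ‖x‖ ^ (η - 10))) ∧ ∀ F : SchwartzMap (Fin 2 → (EuclideanSpace ℝ (Fin 4))) ℂ, IsOffDiagonal F → MeasureTheory.Integrable (fun x : Fin 2 → (EuclideanSpace ℝ (Fin 4)) => (K (x 0 - x 1) : ℂ) * F x) ∧ S₁ 2 F = ∫ x : Fin 2 → (EuclideanSpace ℝ (Fin 4)), (K (x 0 - x 1) : ℂ) * F x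

/-- **Child 2c · FiniteCouplingBeyondDisc** (v11; was `FiniteCouplingIntermediate` with threshold `betaOne/2`) — child 2 at bare couplings at or beyond the cluster-expansion radius, `betaOne 4 r.ρ ≤ |b|`. OPEN (lattice-gauge-theory phase structure; scope artefact). [MontvayMunster1994 §3.7; Creutz2022 (20.18)] -/
def FiniteCouplingBeyondDisc : Prop :=
  open Literature.MathematicalPhysics.QuantumLattice Literature.MathematicalPhysics.AQFT Literature.MathematicalPhysics.QuantumFieldTheory in ∀ (G : Type) [Group G] [TopologicalSpace G] [IsTopologicalGroup G] [CompactSpace G] [MeasurableSpace G] [BorelSpace G], IsCompactSimpleLieGroup G → ∀ (r : LatticeRep G) (sch : SpeciesScheme (YMSpecies G)) (S₁ : SchwingerFamily (EuclideanSpace ℝ (Fin 4))), ((∀ (n : ℕ), n ≠ 0 → ∀ (f : Fin n → SchwartzMap ((EuclideanSpace ℝ (Fin 4))) ℝ) (F : SchwartzMap (Fin n → (EuclideanSpace ℝ (Fin 4))) ℂ), IsTensorOf F (fun i => ofRealTest (f i)) → IsOffDiagonal F → Filter.Tendsto (fun k : ℕ => ((latticeSchwinger r.ρ sch (fun s =>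 s.F) k n (fun _ => r.curvature) f : ℝ) : ℂ)) Filter.atTop (nhds (S₁ n F))) ∧ (S₁.toLabelled.IsNormalized ∧ S₁.toLabelled.IsHermitian ∧ S₁.toLabelled.HasLinearGrowth ∧ S₁.toLabelled.IsReflectionPositive ∧ S₁.toLabelled.IsSymmetric ∧ S₁.toLabelled.HasClusterProperty) ∧ (∀ (n : ℕ) (a : (EuclideanSpace ℝ (Fin 4))) (F : SchwartzMap (Fin n → (EuclideanSpace ℝ (Fin 4))) ℂ), IsOffDiagonal F → S₁ n (translateMulti a F) = S₁ n F) ∧ (∀ (R : (EuclideanSpace ℝ (Fin 4)) ≃ₗᵢ[ℝ] (EuclideanSpace ℝ (Fin 4))), LinearMap.det (R.toLinearEquiv : (EuclideanSpace ℝ (Fin 4)) →ₗ[ℝ] (EuclideanSpace ℝ (Fin 4))) = 1 → (∀ i : Fin 4, ∃ j : Fin 4, R (EuclideanSpace.single i 1) = EuclideanSpace.single j 1 ∨ R (EuclideanSpace.single i 1) = -EuclideanSpace.single j 1) → ∀ (n : ℕ) (F : SchwartzMap (Fin n → (EuclideanSpace ℝ (Fin 4))) ℂ), IsOffDiagonal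 F → S₁ n (linActMulti R F) = S₁ n F) ∧ (∃ Δ : ℝ, 0 < Δ ∧ S₁.toLabelled.HasMassGap Δ ∧ HasLatticeMassGap r sch Δ)) → (∃ b : ℝ, Filter.Tendsto sch.β Filter.atTop (nhds b) ∧ betaOne 4 r.ρ ≤ |b|) → ∃ (K : (EuclideanSpace ℝ (Fin 4)) → ℝ) (C η : ℝ), 0 < η ∧ ContinuousOn K {x : (EuclideanSpace ℝ (Fin 4)) | x ≠ 0} ∧ (∀ x : (EuclideanSpace ℝ (Fin 4)), x ≠ 0 → |K x| ≤ C * (1 + ‖x‖ ^ (η - 10))) ∧ ∀ F : SchwartzMap (Fin 2 → (EuclideanSpace ℝ (Fin 4))) ℂ, IsOffDiagonal F → MeasureTheory.Integrable (fun x : Fin 2 → (EuclideanSpace ℝ (Fin 4)) => (K (x 0 - x 1) : ℂ) * F x) ∧ S₁ 2 F = ∫ x : Fin 2 → (EuclideanSpace ℝ (Fin 4)), (K (x 0 - x 1) : ℂ) * F x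


/-! ## Registered stubs `stub_<name>` (`sorry` lives ONLY here) -/

/-- **stub_weakCoupling** = child 1 `WeakCoupling` (OPEN — THE WALL: the ultraviolet half of the 4D Yang–Mills construction in the curvature channel for asymptotically free schemes; parked, typed, not claimed). Size XL (open problem). [JaffeWitten2000 §6.5; Balaban1989LargeFieldII; MagnenRivasseauSeneor1993] -/
theorem stub_weakCoupling : open Literature.MathematicalPhysics.QuantumLattice Literature.MathematicalPhysics.AQFT Literature.MathematicalPhysics.QuantumFieldTheory in ∀ (G : Type) [Group G] [TopologicalSpace G] [IsTopologicalGroup G] [CompactSpace G] [MeasurableSpace G] [BorelSpace G], IsCompactSimpleLieGroup G → ∀ (r : LatticeRep G) (sch : SpeciesScheme (YMSpecies G)) (S₁ : SchwingerFamily (EuclideanSpace ℝ (Fin 4))), ((∀ (n : ℕ), n ≠ 0 → ∀ (f : Fin n → SchwartzMap ((EuclideanSpace ℝ (Fin 4))) ℝ) (F : SchwartzMap (Fin n → (EuclideanSpace ℝ (Fin 4))) ℂ), IsTensorOf F (fun i => ofRealTest (f i)) → IsOffDiagonal F → Filter.Tendsto (fun k : ℕ => ((latticeSchwinger r.ρ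 sch (fun s => s.F) k n (fun _ => r.curvature) f : ℝ) : ℂ)) Filter.atTop (nhds (S₁ n F))) ∧ (S₁.toLabelled.IsNormalized ∧ S₁.toLabelled.IsHermitian ∧ S₁.toLabelled.HasLinearGrowth ∧ S₁.toLabelled.IsReflectionPositive ∧ S₁.toLabelled.IsSymmetric ∧ S₁.toLabelled.HasClusterProperty) ∧ (∀ (n : ℕ) (a : (EuclideanSpace ℝ (Fin 4))) (F : SchwartzMap (Fin n → (EuclideanSpace ℝ (Fin 4))) ℂ), IsOffDiagonal F → S₁ n (translateMulti a F) = S₁ n F) ∧ (∀ (R : (EuclideanSpace ℝ (Fin 4)) ≃ₗᵢ[ℝ] (EuclideanSpace ℝ (Fin 4))), LinearMap.det (R.toLinearEquiv : (EuclideanSpace ℝ (Fin 4)) →ₗ[ℝ] (EuclideanSpace ℝ (Fin 4))) = 1 → (∀ i : Fin 4, ∃ j : Fin 4, R (EuclideanSpace.single i 1) = EuclideanSpace.single j 1 ∨ R (EuclideanSpace.single i 1) = -EuclideanSpace.single j 1) → ∀ (n : ℕ) (F : SchwartzMap (Fin n → (EuclideanSpace ℝ (Fin 4))) ℂ), IsOffDiagonal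 F → S₁ n (linActMulti R F) = S₁ n F) ∧ (∃ Δ : ℝ, 0 < Δ ∧ S₁.toLabelled.HasMassGap Δ ∧ HasLatticeMassGap r sch Δ)) → sch.HasWeakCouplingLimit → ∃ (K : (EuclideanSpace ℝ (Fin 4)) → ℝ) (C η : ℝ), 0 < η ∧ ContinuousOn K {x : (EuclideanSpace ℝ (Fin 4)) | x ≠ 0} ∧ (∀ x : (EuclideanSpace ℝ (Fin 4)), x ≠ 0 → |K x| ≤ C * (1 + ‖x‖ ^ (η - 10))) ∧ ∀ F : SchwartzMap (Fin 2 → (EuclideanSpace ℝ (Fin 4))) ℂ, IsOffDiagonal F → MeasureTheory.Integrable (fun x : Fin 2 → (EuclideanSpace ℝ (Fin 4)) => (K (x 0 - x 1) : ℂ) * F x) ∧ S₁ 2 F = ∫ x : Fin 2 → (EuclideanSpace ℝ (Fin 4)), (K (x 0 - x 1) : ℂ) * F x := by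
  sorry

/-- **stub_finiteCouplingStrongHyperCore** = child 2b′ (OPEN residue of child 2 inside the cluster-expansion disc `|b| < betaOne 4 r.ρ` with hyper-exponential
renormalisation and no admissible mild rate; SCOPE ARTEFACT served by no `closes`; v14's stub of this name, signature verbatim). Size L. [OsterwalderSeiler1978; Seiler1982] -/
theorem stub_finiteCouplingStrongHyperCore : FiniteCouplingStrongHyperCore := by
  sorry

/-- **stub_finiteCouplingBeyondDisc** = child 2c (OPEN residue of child 2 at or beyond the cluster-expansion radius `betaOne 4 r.ρ ≤ |b|`; SCOPE ARTEFACT;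
v14's stub of this name, signature verbatim). Size L–XL (no convergent expansion is known there). [Seiler1982; OsterwalderSeiler1978] -/
theorem stub_finiteCouplingBeyondDisc : FiniteCouplingBeyondDisc := by
  sorry

/-- **stub_negativeCoupling** = child 3 (OPEN; SCOPE ARTEFACT: `β_k → −∞`, frustrated Wilson coupling, no reflection positivity on odd tori). Size L. [OsterwalderSeiler1978; Seiler1982] -/
theorem stub_negativeCoupling : open Literature.MathematicalPhysics.QuantumLattice Literature.MathematicalPhysics.AQFT Literature.MathematicalPhysics.QuantumFieldTheory in ∀ (G : Type) [Group G] [TopologicalSpace G] [IsTopologicalGroup G] [CompactSpace G] [MeasurableSpace G] [BorelSpace G], IsCompactSimpleLieGroup G → ∀ (r : LatticeRep G) (sch : SpeciesScheme (YMSpecies G)) (S₁ : SchwingerFamily (EuclideanSpace ℝ (Fin 4))), ((∀ (n : ℕ), n ≠ 0 → ∀ (f : Fin n → SchwartzMap ((EuclideanSpace ℝ (Fin 4))) ℝ) (F : SchwartzMap (Fin n → (EuclideanSpace ℝ (Fin 4))) ℂ), IsTensorOf F (fun i => ofRealTest (f i)) → IsOffDiagonal F → Filter.Tendsto (fun k :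 ℕ => ((latticeSchwinger r.ρ sch (fun s => s.F) k n (fun _ => r.curvature) f : ℝ) : ℂ)) Filter.atTop (nhds (S₁ n F))) ∧ (S₁.toLabelled.IsNormalized ∧ S₁.toLabelled.IsHermitian ∧ S₁.toLabelled.HasLinearGrowth ∧ S₁.toLabelled.IsReflectionPositive ∧ S₁.toLabelled.IsSymmetric ∧ S₁.toLabelled.HasClusterProperty) ∧ (∀ (n : ℕ) (a : (EuclideanSpace ℝ (Fin 4))) (F : SchwartzMap (Fin n → (EuclideanSpace ℝ (Fin 4))) ℂ), IsOffDiagonal F → S₁ n (translateMulti a F) = S₁ n F) ∧ (∀ (R : (EuclideanSpace ℝ (Fin 4)) ≃ₗᵢ[ℝ] (EuclideanSpace ℝ (Fin 4))), LinearMap.det (R.toLinearEquiv : (EuclideanSpace ℝ (Fin 4)) →ₗ[ℝ] (EuclideanSpace ℝ (Fin 4))) = 1 → (∀ i : Fin 4, ∃ j : Fin 4, R (EuclideanSpace.single i 1) = EuclideanSpace.single j 1 ∨ R (EuclideanSpace.single i 1) = -EuclideanSpace.single j 1) → ∀ (n : ℕ) (F : SchwartzMap (Fin n → (EuclideanSpace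 ℝ (Fin 4))) ℂ), IsOffDiagonal F → S₁ n (linActMulti R F) = S₁ n F) ∧ (∃ Δ : ℝ, 0 < Δ ∧ S₁.toLabelled.HasMassGap Δ ∧ HasLatticeMassGap r sch Δ)) → Filter.Tendsto sch.β Filter.atTop Filter.atBot → ∃ (K : (EuclideanSpace ℝ (Fin 4)) → ℝ) (C η : ℝ), 0 < η ∧ ContinuousOn K {x : (EuclideanSpace ℝ (Fin 4)) | x ≠ 0} ∧ (∀ x : (EuclideanSpace ℝ (Fin 4)), x ≠ 0 → |K x| ≤ C * (1 + ‖x‖ ^ (η - 10))) ∧ ∀ F : SchwartzMap (Fin 2 → (EuclideanSpace ℝ (Fin 4))) ℂ, IsOffDiagonal F → MeasureTheory.Integrable (fun x : Fin 2 → (EuclideanSpace ℝ (Fin 4)) => (K (x 0 - x 1) : ℂ) * F x) ∧ S₁ 2 F = ∫ x : Fin 2 → (EuclideanSpace ℝ (Fin 4)), (K (x 0 - x 1) : ℂ) * F x := by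
  sorry

/-! ## The route-item (letI) forms of the children and their equivalence with the stubs (kernel-checked) -/

namespace Child

/-- Route item `CurvatureKernelBoundWeakCoupling`, VERBATIM as filed in `children.json`. -/
def WeakCoupling : Prop :=
  open Literature.MathematicalPhysics.QuantumLattice Literature.MathematicalPhysics.AQFT Literature.MathematicalPhysics.QuantumFieldTheory in let E := EuclideanSpace ℝ (Fin 4); ∀ (G : Type) [Group G] [TopologicalSpace G] [IsTopologicalGroup G] [CompactSpace G], IsCompactSimpleLieGroup G → letI : MeasurableSpace G := borel G; haveI : BorelSpace G := ⟨rfl⟩; let W₁ := fun (r : LatticeRep G) (sch : SpeciesScheme (YMSpecies G)) (S₁ : SchwingerFamily E) => ((∀ (n : ℕ), n ≠ 0 → ∀ (f : Fin n → SchwartzMap (E) ℝ) (F : SchwartzMap (Fin n → E) ℂ), IsTensorOf F (fun i => ofRealTest (f i)) → IsOffDiagonal F → Filter.Tendsto (fun k : ℕ => ((latticeSchwinger r.ρ sch (fun s => s.F) k n (fun _ => r.curvature) f : ℝ) : ℂ)) Filter.atTop (nhds (S₁ n F))) ∧ (S₁.toLabelled.IsNormalized ∧ S₁.toLabelled.IsHermitian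 ∧ S₁.toLabelled.HasLinearGrowth ∧ S₁.toLabelled.IsReflectionPositive ∧ S₁.toLabelled.IsSymmetric ∧ S₁.toLabelled.HasClusterProperty) ∧ (∀ (n : ℕ) (a : E) (F : SchwartzMap (Fin n → E) ℂ), IsOffDiagonal F → S₁ n (translateMulti a F) = S₁ n F) ∧ (∀ (R : E ≃ₗᵢ[ℝ] E), LinearMap.det (R.toLinearEquiv : E →ₗ[ℝ] E) = 1 → (∀ i : Fin 4, ∃ j : Fin 4, R (EuclideanSpace.single i 1) = EuclideanSpace.single j 1 ∨ R (EuclideanSpace.single i 1) = -EuclideanSpace.single j 1) → ∀ (n : ℕ) (F : SchwartzMap (Fin n → E) ℂ), IsOffDiagonal F → S₁ n (linActMulti R F) = S₁ n F) ∧ (∃ Δ : ℝ, 0 < Δ ∧ S₁.toLabelled.HasMassGap Δ ∧ HasLatticeMassGap r sch Δ)); ∀ (r : LatticeRep G) (sch : SpeciesScheme (YMSpecies G)) (S₁ : SchwingerFamily E), W₁ r sch S₁ → sch.HasWeakCouplingLimit → ∃ (K : E → ℝ) (C η : ℝ), 0 < η ∧ ContinuousOn K {x : E | x ≠ 0} ∧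 (∀ x : E, x ≠ 0 → |K x| ≤ C * (1 + ‖x‖ ^ (η - 10))) ∧ ∀ F : SchwartzMap (Fin 2 → E) ℂ, IsOffDiagonal F → MeasureTheory.Integrable (fun x : Fin 2 → E => (K (x 0 - x 1) : ℂ) * F x) ∧ S₁ 2 F = ∫ x : Fin 2 → E, (K (x 0 - x 1) : ℂ) * F x

/-- Route item `CurvatureKernelBoundFiniteCoupling`, VERBATIM. -/
def FiniteCoupling : Prop :=
  open Literature.MathematicalPhysics.QuantumLattice Literature.MathematicalPhysics.AQFT Literature.MathematicalPhysics.QuantumFieldTheory in let E := EuclideanSpace ℝ (Fin 4); ∀ (G : Type) [Group G] [TopologicalSpace G] [IsTopologicalGroup G] [CompactSpace G], IsCompactSimpleLieGroup G → letI : MeasurableSpace G := borel G; haveI : BorelSpace G := ⟨rfl⟩; let W₁ := fun (r : LatticeRep G) (sch : SpeciesScheme (YMSpecies G)) (S₁ : SchwingerFamily E) => ((∀ (n : ℕ), n ≠ 0 → ∀ (f : Fin n → SchwartzMap (E) ℝ) (F : SchwartzMap (Fin n → E) ℂ), IsTensorOf F (fun i => ofRealTest (f i)) → IsOffDiagonal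 F → Filter.Tendsto (fun k : ℕ => ((latticeSchwinger r.ρ sch (fun s => s.F) k n (fun _ => r.curvature) f : ℝ) : ℂ)) Filter.atTop (nhds (S₁ n F))) ∧ (S₁.toLabelled.IsNormalized ∧ S₁.toLabelled.IsHermitian ∧ S₁.toLabelled.HasLinearGrowth ∧ S₁.toLabelled.IsReflectionPositive ∧ S₁.toLabelled.IsSymmetric ∧ S₁.toLabelled.HasClusterProperty) ∧ (∀ (n : ℕ) (a : E) (F : SchwartzMap (Fin n → E) ℂ), IsOffDiagonal F → S₁ n (translateMulti a F) = S₁ n F) ∧ (∀ (R : E ≃ₗᵢ[ℝ] E), LinearMap.det (R.toLinearEquiv : E →ₗ[ℝ] E) = 1 → (∀ i : Fin 4, ∃ j : Fin 4, R (EuclideanSpace.single i 1) = EuclideanSpace.single j 1 ∨ R (EuclideanSpace.single i 1) = -EuclideanSpace.single j 1) → ∀ (n : ℕ) (F : SchwartzMap (Fin n → E) ℂ), IsOffDiagonal F → S₁ n (linActMulti R F) = S₁ n F) ∧ (∃ Δ : ℝ, 0 < Δ ∧ S₁.toLabelled.HasMassGap Δ ∧ HasLatticeMassGap r sch Δ));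 ∀ (r : LatticeRep G) (sch : SpeciesScheme (YMSpecies G)) (S₁ : SchwingerFamily E), W₁ r sch S₁ → (∃ b : ℝ, Filter.Tendsto sch.β Filter.atTop (nhds b)) → ∃ (K : E → ℝ) (C η : ℝ), 0 < η ∧ ContinuousOn K {x : E | x ≠ 0} ∧ (∀ x : E, x ≠ 0 → |K x| ≤ C * (1 + ‖x‖ ^ (η - 10))) ∧ ∀ F : SchwartzMap (Fin 2 → E) ℂ, IsOffDiagonal F → MeasureTheory.Integrable (fun x : Fin 2 → E => (K (x 0 - x 1) : ℂ) * F x) ∧ S₁ 2 F = ∫ x : Fin 2 → E, (K (x 0 - x 1) : ℂ) * F x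

/-- Route item `CurvatureKernelBoundNegativeCoupling`, VERBATIM. -/
def NegativeCoupling : Prop :=
  open Literature.MathematicalPhysics.QuantumLattice Literature.MathematicalPhysics.AQFT Literature.MathematicalPhysics.QuantumFieldTheory in let E := EuclideanSpace ℝ (Fin 4); ∀ (G : Type) [Group G] [TopologicalSpace G] [IsTopologicalGroup G] [CompactSpace G], IsCompactSimpleLieGroup G → letI : MeasurableSpace G := borel G; haveI : BorelSpace G := ⟨rfl⟩; let W₁ := fun (r : LatticeRep G) (sch : SpeciesScheme (YMSpecies G)) (S₁ : SchwingerFamily E) => ((∀ (n : ℕ), n ≠ 0 → ∀ (f : Fin n → SchwartzMap (E) ℝ) (F : SchwartzMap (Fin n → E) ℂ), IsTensorOf F (fun i => ofRealTest (f i)) → IsOffDiagonal F → Filter.Tendsto (fun k : ℕ => ((latticeSchwinger r.ρ sch (fun s => s.F) k n (fun _ => r.curvature) f : ℝ) : ℂ)) Filter.atTop (nhds (S₁ n F))) ∧ (S₁.toLabelled.IsNormalized ∧ S₁.toLabelled.IsHermitian ∧ S₁.toLabelled.HasLinearGrowth ∧ S₁.toLabelled.IsReflectionPositive ∧ S₁.toLabelled.IsSymmetric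 ∧ S₁.toLabelled.HasClusterProperty) ∧ (∀ (n : ℕ) (a : E) (F : SchwartzMap (Fin n → E) ℂ), IsOffDiagonal F → S₁ n (translateMulti a F) = S₁ n F) ∧ (∀ (R : E ≃ₗᵢ[ℝ] E), LinearMap.det (R.toLinearEquiv : E →ₗ[ℝ] E) = 1 → (∀ i : Fin 4, ∃ j : Fin 4, R (EuclideanSpace.single i 1) = EuclideanSpace.single j 1 ∨ R (EuclideanSpace.single i 1) = -EuclideanSpace.single j 1) → ∀ (n : ℕ) (F : SchwartzMap (Fin n → E) ℂ), IsOffDiagonal F → S₁ n (linActMulti R F) = S₁ n F) ∧ (∃ Δ : ℝ, 0 < Δ ∧ S₁.toLabelled.HasMassGap Δ ∧ HasLatticeMassGap r sch Δ)); ∀ (r : LatticeRep G) (sch : SpeciesScheme (YMSpecies G)) (S₁ : SchwingerFamily E), W₁ r sch S₁ → Filter.Tendsto sch.β Filter.atTop Filter.atBot → ∃ (K : E → ℝ) (C η : ℝ), 0 < η ∧ ContinuousOn K {x : E | x ≠ 0} ∧ (∀ x : E, x ≠ 0 → |K x| ≤ C * (1 + ‖x‖ ^ (η - 10))) ∧ ∀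 F : SchwartzMap (Fin 2 → E) ℂ, IsOffDiagonal F → MeasureTheory.Integrable (fun x : Fin 2 → E => (K (x 0 - x 1) : ℂ) * F x) ∧ S₁ 2 F = ∫ x : Fin 2 → E, (K (x 0 - x 1) : ℂ) * F x

end Child

/-- Stub form ⟺ route-item form (the `BorelSpace` instance binder is the propositional equation `‹_› = borel G`). [folklore] -/
theorem weakCoupling_iff_child : WeakCoupling ↔ Child.WeakCoupling := by
  constructor
  · intro h G _ _ _ _ hG W₁ r sch S₁ hW₁ hx
    letI : MeasurableSpace G := borel G
    haveI : BorelSpace G := ⟨rfl⟩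
    exact h G hG r sch S₁ hW₁ hx
  · intro h G _ _ _ _ m hB hG r sch S₁ hW₁ hx
    obtain ⟨hm⟩ := hB
    subst hm
    exact h G hG r sch S₁ hW₁ hx

/-- Stub form ⟺ route-item form. [folklore] -/
theorem finiteCoupling_iff_child : FiniteCoupling ↔ Child.FiniteCoupling := by
  constructor
  · intro h G _ _ _ _ hG W₁ r sch S₁ hW₁ hx
    letI : MeasurableSpace G := borel G
    haveI : BorelSpace G := ⟨rfl⟩
    exact h G hG r sch S₁ hW₁ hx
  · intro h G _ _ _ _ m hB hG r sch S₁ hW₁ hx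
    obtain ⟨hm⟩ := hB
    subst hm
    exact h G hG r sch S₁ hW₁ hx

/-- Stub form ⟺ route-item form. [folklore] -/
theorem negativeCoupling_iff_child : NegativeCoupling ↔ Child.NegativeCoupling := by
  constructor
  · intro h G _ _ _ _ hG W₁ r sch S₁ hW₁ hx
    letI : MeasurableSpace G := borel G
    haveI : BorelSpace G := ⟨rfl⟩
    exact h G hG r sch S₁ hW₁ hx
  · intro h G _ _ _ _ m hB hG r sch S₁ hW₁ hx
    obtain ⟨hm⟩ := hB
    subst hm
    exact h G hG r sch S₁ hW₁ hx

/-! ## Child 2 `FiniteCoupling` = its four parts (pure logic) -/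

/-- **Child 2 from its two OPEN parts** (v17; the tempered part p156874 and the mildly-extensive part p157183 are the imported TREE THEOREMS): the coupling dichotomy `|b| < betaOne ∨ betaOne ≤ |b|`, the renormalisation
dichotomy tempered ∨ hyper, and — inside hyper — either some admissible rate `θ` (`e^θ |b| < betaOne`) with
`∃ᶠ k, 0 ≤ β_k ∧ log c_k² ≤ θ L_k`, or its negation for every admissible `θ`. [folklore] -/
theorem finiteCoupling_of_partsR
    (hC : FiniteCouplingStrongHyperCore) (hB : FiniteCouplingBeyondDisc) : FiniteCoupling := by
  have hT := @Summit.QuantumFields.YangMills.Theorems.CurvatureKernel.FiniteCouplingStrongTemperedR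
  have hM := @Summit.QuantumFields.YangMills.Theorems.CurvatureKernel.FiniteCouplingStrongMildlyExtensive
  intro G _ _ _ _ _ _ hG r sch S₁ hW₁ hb
  obtain ⟨b, hb⟩ := hb
  by_cases hlt : |b| < betaOne 4 r.ρ
  · by_cases htemp : ∃ δ₀ : ℝ, ∃ᶠ k in Filter.atTop, sch.c r.curvature k ^ 2 * Real.exp (-(δ₀ / sch.a k)) ≤ 1
    · exact hT G hG r sch S₁ hW₁ ⟨b, hb, hlt⟩ htemp
    · have hhyp : ∀ δ : ℝ, ∀ᶠ k in Filter.atTop, 1 < sch.c r.curvature k ^ 2 * Real.exp (-(δ / sch.a k)) :=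
        fun δ => (Filter.not_frequently.1 (not_exists.1 htemp δ)).mono fun k hk => not_le.1 hk
      by_cases hmild : ∃ θ : ℝ, Real.exp θ * |b| < betaOne 4 r.ρ ∧
          ∃ᶠ k in Filter.atTop, 0 ≤ sch.β k ∧ Real.log (sch.c r.curvature k ^ 2) ≤ θ * sch.L k
      · obtain ⟨θ, hθ, hfr⟩ := hmild
        exact hM G hG r sch S₁ hW₁ b hb hlt θ hθ hfr
      · refine hC G hG r sch S₁ hW₁ b hb hlt hhyp fun θ hθ => ?_
        have h : ¬ ∃ᶠ k in Filter.atTop, 0 ≤ sch.β k ∧ Real.log (sch.c r.curvature k ^ 2) ≤ θ * sch.L k :=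
          fun hfr => hmild ⟨θ, hθ, hfr⟩
        exact (Filter.not_frequently.1 h).mono fun k hk => by
          rcases not_and_or.1 hk with h1 | h1
          · exact Or.inl (not_le.1 h1)
          · exact Or.inr (not_le.1 h1)
  · exact hB G hG r sch S₁ hW₁ ⟨b, hb, not_lt.1 hlt⟩


/-! ## The composition (kernel-checked; no `sorry` below this line) -/

/-- **Children ⇒ crux body** (literal form, via the LANDED glue `Summit.QuantumFields.YangMills.Theorems.CurvatureKernel.CurvatureKernelBound_of_subs` (p137385, imported) applied to the route-item forms). [folklore] -/
theorem curvatureKernelBound_of_children (hW : WeakCoupling) (hF : FiniteCoupling) (hN : NegativeCoupling) :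
    (let E := EuclideanSpace ℝ (Fin 4); ∀ (G : Type) [Group G] [TopologicalSpace G] [IsTopologicalGroup G] [CompactSpace G], IsCompactSimpleLieGroup G → letI : MeasurableSpace G := borel G; haveI : BorelSpace G := ⟨rfl⟩; let W₁ := fun (r : LatticeRep G) (sch : SpeciesScheme (YMSpecies G)) (S₁ : SchwingerFamily E) => ((∀ (n : ℕ), n ≠ 0 → ∀ (f : Fin n → SchwartzMap (E) ℝ) (F : SchwartzMap (Fin n → E) ℂ), IsTensorOf F (fun i => ofRealTest (f i)) → IsOffDiagonal F → Filter.Tendsto (fun k : ℕ => ((latticeSchwinger r.ρ sch (fun s => s.F) k n (fun _ => r.curvature) f : ℝ) : ℂ)) Filter.atTop (nhds (S₁ n F))) ∧ (S₁.toLabelled.IsNormalized ∧ S₁.toLabelled.IsHermitian ∧ S₁.toLabelled.HasLinearGrowth ∧ S₁.toLabelled.IsReflectionPositive ∧ S₁.toLabelled.IsSymmetric ∧ S₁.toLabelled.HasClusterProperty) ∧ (∀ (n : ℕ) (a : E) (F : SchwartzMap (Fin n → E) ℂ), IsOffDiagonal F → S₁ n (translateMulti a F) = S₁ n F) ∧ (∀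 (R : E ≃ₗᵢ[ℝ] E), LinearMap.det (R.toLinearEquiv : E →ₗ[ℝ] E) = 1 → (∀ i : Fin 4, ∃ j : Fin 4, R (EuclideanSpace.single i 1) = EuclideanSpace.single j 1 ∨ R (EuclideanSpace.single i 1) = -EuclideanSpace.single j 1) → ∀ (n : ℕ) (F : SchwartzMap (Fin n → E) ℂ), IsOffDiagonal F → S₁ n (linActMulti R F) = S₁ n F) ∧ (∃ Δ : ℝ, 0 < Δ ∧ S₁.toLabelled.HasMassGap Δ ∧ HasLatticeMassGap r sch Δ)); ∀ (r : LatticeRep G) (sch : SpeciesScheme (YMSpecies G)) (S₁ : SchwingerFamily E), W₁ r sch S₁ → ∃ (K : E → ℝ) (C η : ℝ), 0 < η ∧ ContinuousOn K {x : E | x ≠ 0} ∧ (∀ x : E, x ≠ 0 → |K x| ≤ C * (1 + ‖x‖ ^ (η - 10))) ∧ ∀ F : SchwartzMap (Fin 2 → E) ℂ, IsOffDiagonal F → MeasureTheory.Integrable (fun x : Fin 2 → E => (K (x 0 - x 1) : ℂ) * F x) ∧ S₁ 2 F = ∫ x : Fin 2 → E, (K (x 0 - x 1) : ℂ) * F x)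 :=
  Summit.QuantumFields.YangMills.Theorems.CurvatureKernel.CurvatureKernelBound_of_subs (weakCoupling_iff_child.1 hW) (finiteCoupling_iff_child.1 hF)
    (negativeCoupling_iff_child.1 hN)

/-- **Composition `CurvatureKernelBound_of`**: the registered stubs `stub_weakCoupling`, `stub_finiteCouplingStrongHyperCore`, `stub_finiteCouplingBeyondDisc`, `stub_negativeCoupling` (v17 = v14's four, child 2's landed parts imported) give the
crux BY NAME (PencilRigidity's decl = the item's decl of record; the ONLY theorem in this file concluding that decl, so the skeleton audit is
unambiguous). [folklore] -/
theorem CurvatureKernelBound_of : Summit.QuantumFields.YangMills.Theses.PencilRigidity.CurvatureKernelBound :=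
  curvatureKernelBound_of_children stub_weakCoupling
    (finiteCoupling_of_partsR stub_finiteCouplingStrongHyperCore stub_finiteCouplingBeyondDisc) stub_negativeCoupling

/-! ## The three other routes sharing the item (bodies verbatim identical; `shared_closes` on stmt-QuantumFields-11687) -/

/-- MirrorModularBoosts' copy of the crux is the same proposition (verbatim body). [folklore] -/
theorem shared_iff_MirrorModularBoosts :
    Summit.QuantumFields.YangMills.Theses.MirrorModularBoosts.CurvatureKernelBound ↔
      Summit.QuantumFields.YangMills.Theses.PencilRigidity.CurvatureKernelBound := Iff.rfl

/-- CertificationLength's copy of the crux is the same proposition (verbatim body). [folklore] -/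
theorem shared_iff_CertificationLength :
    Summit.QuantumFields.YangMills.Theses.CertificationLength.CurvatureKernelBound ↔
      Summit.QuantumFields.YangMills.Theses.PencilRigidity.CurvatureKernelBound := Iff.rfl

/-- IsotropyFromPowerCounting's copy of the crux is the same proposition (verbatim body). [folklore] -/
theorem shared_iff_IsotropyFromPowerCounting :
    Summit.QuantumFields.YangMills.Theses.IsotropyFromPowerCounting.CurvatureKernelBound ↔
      Summit.QuantumFields.YangMills.Theses.PencilRigidity.CurvatureKernelBound := Iff.rfl

/-- **Composition for route MirrorModularBoosts** (O(4) cluster, r3): its crux decl BY NAME (same proposition). [folklore] -/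
theorem CurvatureKernelBound_of_MirrorModularBoosts :
    Summit.QuantumFields.YangMills.Theses.MirrorModularBoosts.CurvatureKernelBound :=
  CurvatureKernelBound_of

/-- **Composition for route IsotropyFromPowerCounting** (O(4) cluster, r4): its crux decl BY NAME (same proposition). [folklore] -/
theorem CurvatureKernelBound_of_IsotropyFromPowerCounting :
    Summit.QuantumFields.YangMills.Theses.IsotropyFromPowerCounting.CurvatureKernelBound :=
  CurvatureKernelBound_of

/-- **Composition for route CertificationLength** (r5): its crux decl BY NAME (same proposition). [folklore] -/
theorem CurvatureKernelBound_of_CertificationLength :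
    Summit.QuantumFields.YangMills.Theses.CertificationLength.CurvatureKernelBound :=
  CurvatureKernelBound_of

/-- Sanity (each child is WEAKER than the crux): the crux implies the three children (hence all five stubs). -/
theorem children_of_crux (h : Summit.QuantumFields.YangMills.Theses.PencilRigidity.CurvatureKernelBound) :
    WeakCoupling ∧ FiniteCoupling ∧ NegativeCoupling := by
  refine ⟨?_, ?_, ?_⟩
  · intro G _ _ _ _ m hB hG r sch S₁ hW₁ _
    obtain ⟨hm⟩ := hB
    subst hm
    exact h G hG r sch S₁ hW₁
  · intro G _ _ _ _ m hB hG r sch S₁ hW₁ _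
    obtain ⟨hm⟩ := hB
    subst hm
    exact h G hG r sch S₁ hW₁
  · intro G _ _ _ _ m hB hG r sch S₁ hW₁ _
    obtain ⟨hm⟩ := hB
    subst hm
    exact h G hG r sch S₁ hW₁

end Summit.QuantumFields.YangMills.Cruxes.CurvatureKernelBound.CouplingTrichotomyPortable

end
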